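import Summits.QuantumFields.BalabanUV.T4Continuum.Support.NE3EndpointChart
import Summits.QuantumFields.BalabanUV.T4Continuum.Support.MinimalActionWitness
import HarnessLib

/-!
# T⁴ programme, node NE3 — NON-VACUITY OF THE TWO PATH-CHART HYPOTHESIS SHAPES `ChartPath` AND `EndpointChart` AT THE FLAT DATUM
# (referee pass 25, INFO-62 ∕ INFO-64: «a flat-datum `ChartPath` witness (W = 1, Γ ≡ 0) is still owed»)

NE3 formalisation swarm `b2b-balaban-t4-ne3-formalise-*`, LEAF PROVER 04 (gen 6); A-NV-style node in the pattern of the owner's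
`NE3EnergyAssembly.routeLeaves_flat`.  In the flat class `MinimalActionWitness.flatClass` (the singleton `{1}` at every level) with the
flat datum and the flat pair of configurations, the trivial data — gauge `u = 1`, constant path `Γ ≡ 0`, velocity `Ψ ≡ 0`, acceleration
`Ψ′ ≡ 0`, tangent space `T = {0}`, ANY size functional `Nrm` with `Nrm 0 = 0` — satisfy every field of the junction's `ChartPath`
(`NE3EnergyRateWSupOfSlicePoincare`, p234854) for all constants `θ, κ, θ₀` and every radius `a ≥ 0` (each inequality reads `0 ≤ 0` or
`c·0 ≤ c·0`), and hence — through the owner's only constructor `NE3EndpointChart.endpointChart_of_chartPath` (p235906) — every field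
of `EndpointChart` with `q = 0`.  So both hypothesis structures are CONSISTENT (inhabited), which is all this file says.

CONTENT (all [folklore]; 0 sorry; 0 def): `zeroDir_sub_zeroDir`, **`chartPath_flat`**, **`endpointChart_flat`**, and the instances with
the junction's own norm `Nrm := energyNormW L k (cavg L flatCfg) · (periodBox (N·L^k))` (`NE3EnergyWeightedShapes.energyNormW_zero`):
`chartPath_flat_energyNormW`, `endpointChart_flat_energyNormW`.

HONEST FRAMING.  Non-vacuity at the FLAT datum only; it says nothing about Bałaban's minimisers, for which `ChartPath` ∕ `EndpointChart`
remain HYPOTHESES (route Π's suppliers Π-R ∕ Π-C ∕ Π-L1 are in flight); (P♮)_W, T-E_w♯ and NE3 are NOT proved; spine PROVED 0∕9; finite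
T⁴ rung (B)+1 — NOT infinite volume, NOT mass gap, NOT BetaPertH, NOT Clay.  ABSOLUTE RULE kept (no printed sentence is a hypothesis).
PLACEMENT: `Summits/QuantumFields/BalabanUV/`.
HONEST DEPENDENCY: continuum YM on T⁴ ⇐ BetaPertH ∧ nine spine estimates (0/9 proved); BetaPertH ⇐ (D1) ∧ (D4) ∧ CAP+tail; G-an2-4 gates asym, D1 and NE2/3/4.
-/

set_option autoImplicit false

open scoped BigOperators Matrix.Norms.L2Operator
open NormedSpace Finset

namespace Summit.QuantumFields.BalabanUV.T4Continuum.NE3EndpointChartFlat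

open Set
open Literature.MathematicalPhysics.QuantumFieldTheory.Balaban1983to89
open B7Prop1Explicit B7Prop2Explicit
open T4AveragingDeficitWall hiding Site Plane Plaq Bond
open T4AveragingDeficitWallBoundary (periodBox)
open AveragingDeficitPeriodicCounting (IsPeriodicDir)
open AveragingDeficitChartCalculus (cavg)
open MinimalActionLevels (perWin)
open MinimalActionSandwich (admissible)
open MinimalActionWitness (flatCfg flatClass flatCfg_mem_admissible fhol_flatCfg)
open NE3EnergyShapes (IsUnitarySite IsPeriodicSite gaugeAct_one rescale_bavg_flatCfg)
open NE3EnergyWeightedShapes (energyNormW energyNormW_zero)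
open NE3EnergyRateWSupOfSlicePoincare (ChartPath)
open NE3EndpointChart (EndpointChart endpointChart_of_chartPath)

noncomputable section

variable {d : ℕ} {n : Type*} [Fintype n] [DecidableEq n]

omit [Fintype n] [DecidableEq n] in
/-- `0 − 0 = 0` for direction fields written as lambdas. [folklore] -/
theorem zeroDir_sub_zeroDir :
    (fun (_ : Site d) (_ : Fin d) => (0 : Matrix n n ℂ)) - (fun (_ : Site d) (_ : Fin d) => (0 : Matrix n n ℂ))
      = fun (_ : Site d) (_ : Fin d) => (0 : Matrix n n ℂ) := by
  funext x μ; simp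

/-- The average of the flat configuration is flat: `cavg L flatCfg = flatCfg`. [folklore] -/
theorem cavg_flatCfg (L : ℕ) : cavg L (flatCfg (d := d) (n := n)) = flatCfg := rescale_bavg_flatCfg L

/-- **NON-VACUITY OF `ChartPath` AT THE FLAT DATUM**: flat class, flat datum and pair, `u = 1`, `Γ = Ψ = Ψ′ ≡ 0`, `T = {0}`, any size
functional with `Nrm 0 = 0`, any `θ κ θ₀`, any `a ≥ 0`. [folklore] -/
theorem chartPath_flat [Nonempty n] (L N k : ℕ) {Nrm : (Site d → Fin d → Matrix n n ℂ) → ℝ}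
    (hNrm : Nrm (fun _ _ => 0) = 0) (θ κ θ₀ : ℝ) {a : ℝ} (ha : 0 ≤ a) :
    ChartPath (flatClass (d := d) (n := n)) L N k flatCfg flatCfg flatCfg (fun _ => 1)
      (fun _ => fun _ _ => 0) (fun _ => fun _ _ => 0) (fun _ => fun _ _ => 0) {fun _ _ => 0} Nrm θ κ θ₀ a := by
  have hvary : ∀ t : ℝ, vary (cavg L (flatCfg (d := d) (n := n)))
      ((fun _ : ℝ => fun (_ : Site d) (_ : Fin d) => (0 : Matrix n n ℂ)) t) 1 = flatCfg := by
    intro t; rw [cavg_flatCfg]; exact vary_zero_dir _ _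
  refine ⟨⟨fun _ => (unitaryUnits (Matrix n n ℂ)).one_mem, fun _ _ => rfl⟩, ?_, rfl, fun _ _ _ => (skewAdjoint _).zero_mem,
    fun _ _ _ _ => rfl, ?_, ?_, fun _ _ => (skewAdjoint _).zero_mem, fun _ _ _ _ => (skewAdjoint _).zero_mem, ?_,
    Set.mem_singleton _, ?_, ?_, ?_, ?_, ?_⟩
  · rw [hvary 0, gaugeAct_one]
  · intro t _ y μ
    simpa using hasDerivAt_const t (NormedSpace.exp (0 : Matrix n n ℂ))
  · intro t _ y μ
    exact hasDerivAt_const t _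
  · intro t _; rw [hvary t]; exact flatCfg_mem_admissible L k
  · intro Y hY
    rw [Set.mem_singleton_iff] at hY
    subst hY
    intro _ _ _; rfl
  · intro t _
    rw [zeroDir_sub_zeroDir, hNrm, mul_zero]
  · rw [hNrm, mul_zero]
  · intro t _ p _
    rw [hvary t, fhol_flatCfg, Units.val_one, sub_self, norm_zero]
    exact ha
  · intro t _
    rw [hvary t, hNrm]
    simp

/-- **NON-VACUITY OF `EndpointChart` AT THE FLAT DATUM** (`q = 0`), through the owner's constructor `endpointChart_of_chartPath`. [folklore] -/
theorem endpointChart_flat [Nonempty n] (L N k : ℕ) {Nrm : (Site d → Fin d → Matrix n n ℂ) → ℝ}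
    (hNrm : Nrm (fun _ _ => 0) = 0) (θ κ θ₀ : ℝ) {a : ℝ} (ha : 0 ≤ a) :
    EndpointChart (flatClass (d := d) (n := n)) L N k flatCfg flatCfg flatCfg (fun _ => 1)
      (fun _ => fun _ _ => 0) (fun _ => fun _ _ => 0) (fun _ => fun _ _ => 0) (fun _ _ => 0) {fun _ _ => 0} Nrm θ κ θ₀ 0 a :=
  endpointChart_of_chartPath (chartPath_flat L N k hNrm θ κ θ₀ ha)

/-- The junction's own size functional vanishes on the zero direction. [folklore] -/
theorem energyNormW_flat_zero (L N k : ℕ) :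
    energyNormW L k (cavg L (flatCfg (d := d) (n := n))) (fun _ _ => 0) (periodBox (N * L ^ k)) = 0 :=
  energyNormW_zero _ _ _ _

/-- `ChartPath` at the flat datum with the junction's norm `N_w = energyNormW L k (cavg L flatCfg) · (periodBox (N·L^k))`. [folklore] -/
theorem chartPath_flat_energyNormW [Nonempty n] (L N k : ℕ) (θ κ θ₀ : ℝ) {a : ℝ} (ha : 0 ≤ a) :
    ChartPath (flatClass (d := d) (n := n)) L N k flatCfg flatCfg flatCfg (fun _ => 1)
      (fun _ => fun _ _ => 0) (fun _ => fun _ _ => 0) (fun _ => fun _ _ => 0) {fun _ _ => 0}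
      (fun Y => energyNormW L k (cavg L flatCfg) Y (periodBox (N * L ^ k))) θ κ θ₀ a :=
  chartPath_flat L N k (energyNormW_flat_zero L N k) θ κ θ₀ ha

/-- `EndpointChart` at the flat datum with the junction's norm (`q = 0`). [folklore] -/
theorem endpointChart_flat_energyNormW [Nonempty n] (L N k : ℕ) (θ κ θ₀ : ℝ) {a : ℝ} (ha : 0 ≤ a) :
    EndpointChart (flatClass (d := d) (n := n)) L N k flatCfg flatCfg flatCfg (fun _ => 1)
      (fun _ => fun _ _ => 0) (fun _ => fun _ _ => 0) (fun _ => fun _ _ => 0) (fun _ _ => 0) {fun _ _ => 0}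
      (fun Y => energyNormW L k (cavg L flatCfg) Y (periodBox (N * L ^ k))) θ κ θ₀ 0 a :=
  endpointChart_flat L N k (energyNormW_flat_zero L N k) θ κ θ₀ ha

end

end Summit.QuantumFields.BalabanUV.T4Continuum.NE3EndpointChartFlat
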